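import Summits.QuantumFields.BalabanUV.Beta.FP.FarRegionBubbleGraded
import Summits.QuantumFields.BalabanUV.Beta.FP.FarRegionMoment

/-!
# `BalabanUV.Beta.FP.FarRegionBubbleMoment` — road «FP» (binder row D1), `RHOA-DESIGN.md` §3 (F-PC) ∕ §5 row RHOA-4 «FAR-REGION MOMENT» (b) «bubble-level», FILE F:
# THE n-FREE FAR SECOND MOMENT OF THE BRACKET BUBBLE OF GRADED DEGREE-2 LEGS (chain with `FP/FarRegionMoment` at `a = 2`) AND THE IDENTITY
# «BUBBLE = BRACKET FORM» UNDER THE TWO PARTIAL ZERO MOMENTS `Σ_x V(x,w) = 0`, `Σ_y W(y,u) = 0`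
# ([folklore] bookkeeping on `ℤ⁴`; G-an2-4 formalisation swarm, unit `b2b-balaban-gan24-formalise-leaf-06`, gen 32, cross-lane idle-seat brick)

HONEST DEPENDENCY (page 1, mandatory): continuum YM on T⁴ ⇐ BetaPertH ∧ nine spine estimates (0/9 proved); BetaPertH ⇐ (D1) ∧ (D4) ∧
CAP+tail; G-an2-4 gates asym, D1 and NE2/3/4.  HONEST FRAMING (cell contract, verbatim): «discharging `BetaPertH` makes Bałaban's UV
stability UNCONDITIONAL — a real constructive-QFT result; it is NOT the continuum limit and NOT the Clay problem.»  THIS MODULE is [folklore] bookkeeping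
over gen-32's `FarRegionBubbleGraded.abs_bracket_le_of_graded` ∕ `FarRegionMoment.sum_far_abs_le ∕ summable_moment` and Mathlib's `Summable.tsum_prod` (Fubini for absolutely
summable families); it asserts nothing about Bałaban's objects, cites nothing, mints no `Prop` fact, has no `def`, 0 sorry.  Whether the H′ route's cubic vertices HAVE the two
partial zero moments (the (T2″)∕H2V Ward∕Noether letters) and whether its legs carry the graded data are the suppliers' rows, NOT here.  NOT `hbook`, NOT `ρ_n = O(1)`,
NOT D1, NOT BetaPertH, NOT continuum, NOT Clay; «not in print; our bookkeeping».

CONTENT.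
* §1 **`sum_far_abs_le_bracket_of_graded`** (`a = 2`): for `Π z := Σ' V(x,w)W(y,u)(F(z+u−x) − F(z+u−w))(G(z+y−w) − G(z+u−w))`,
  `Σ_{z ∈ annulus 4 n R}|Π z·z_μ·z_ν| ≤ 80·((Kb + Kc)·(2!e^{m/2}(2/m)²))·(1 + 2/m)` for every `R ≥ n` (n-FREE) and `Summable (Π·z_μ·z_ν)`.
* §2 `tsum_mul_snd_eq_zero` (`Σ_y K(y,u) = 0 ⟹ Σ'_{(y,u)} K(y,u)h(u) = 0`), `summable_VW_mul`, `summable_W_mul`, `tsum_VW_eq_zero_of_snd` (TYPE A: a factor without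
  `y` dies by `W`'s moment), `tsum_VW_eq_zero_of_fst` (TYPE B: without `x`, by `V`'s), **`bubble_eq_bracket`**:
  `Σ' V(x,w)W(y,u)·F(z+u−x)·G(z+y−w) = Σ' V(x,w)W(y,u)·(F(z+u−x) − F(z+u−w))·(G(z+y−w) − G(z+u−w))`.
Provenance: leaf prover 06 (gen 32), 2026-08-21; no existing file touched.
-/

noncomputable section

namespace Summit.QuantumFields.BalabanUV.Beta.FP.FarRegionBubbleMoment

open Finset Filter Topology fwdDiff
open scoped BigOperators
open Literature.MathematicalPhysics.QuantumFieldTheory.Balaban1983to89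
open Literature.MathematicalPhysics.QuantumFieldTheory.Balaban1983to89.Beta
open B12Sec2to5 (l1 l1_nonneg abs_coord_le_l1)
open ExpKernelCalculus (Site Zl Zl_pos l1_sub_triangle l1_sub_symm)
open DyadicShell (Pt supNorm)
open Summit.QuantumFields.BalabanUV.Beta.FP.HorizontalBookkeepingTail (supNorm_le_add_of_box)
open Summit.QuantumFields.BalabanUV.Beta.FP.ExpLocalisedBubble
open Summit.QuantumFields.BalabanUV.Beta.FP.FarRegionSmear
open Summit.QuantumFields.BalabanUV.Beta.FP.FarRegionBubble
open Summit.QuantumFields.BalabanUV.Beta.FP.FarRegionBubbleGraded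

/-! ## §1 RHOA-4 (b), bubble level — chained with `FP/FarRegionMoment` at `a = 2` (two degree-2 legs): the n-FREE far second moment -/

section BubbleChain

open Literature.Probability.LatticeModels (annulus)
open Summit.QuantumFields.BalabanUV.Beta.FP.FarRegionMoment (sum_far_abs_le summable_moment)

variable {V W : Pt × Pt → ℝ} {F G : Pt → ℝ} {CV CW δ Fg Gg A₀ A₁ B₀ B₁ η m : ℝ} {n : ℕ}

/-- [folklore] **THE n-FREE FAR SECOND MOMENT OF THE BRACKET BUBBLE OF GRADED DEGREE-2 LEGS** (RHOA-4 (b), bubble level, `a = 2`): for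
`Π z := Σ' V(x,w)W(y,u)(F(z+u−x) − F(z+u−w))(G(z+y−w) − G(z+u−w))` under the hypotheses of `abs_bracket_le_of_graded` at `a = 2`,
`Σ_{z ∈ annulus 4 n R}|Π z·z_μ·z_ν| ≤ 80·((Kb + Kc)·(2!·e^{m/2}·(2/m)²))·(1 + 2/m)` for every `R ≥ n` (n-FREE) and `Summable (Π·z_μ·z_ν)` —
`FarRegionMoment.sum_far_abs_le ∕ summable_moment` BY NAME with `(C, δ, b) := (Kb + Kc, m, 2)`. -/
theorem sum_far_abs_le_bracket_of_graded (hδ : 0 < δ)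
    (hV : ∀ p : Pt × Pt, |V p| ≤ CV * (Real.exp (-δ * l1 p.1) * Real.exp (-δ * l1 p.2)))
    (hW : ∀ q : Pt × Pt, |W q| ≤ CW * (Real.exp (-δ * l1 q.1) * Real.exp (-δ * l1 q.2)))
    (hFg : ∀ t, |F t| ≤ Fg) (hGg : ∀ t, |G t| ≤ Gg) (hn : 1 ≤ n) (hη : 0 < η)
    (hA0 : 0 ≤ A₀) (hA1 : 0 ≤ A₁) (hB0 : 0 ≤ B₀) (hB1 : 0 ≤ B₁)
    (hF0g : ∀ t : Pt, 0 < supNorm t → |F t| ≤ A₀ / (supNorm t : ℝ) ^ 2 * Real.exp (-(η / n) * supNorm t))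
    (hF1g : ∀ t : Pt, 0 < supNorm t → ∀ i, |Δ_[(Pi.single i 1 : Pt)] F t|
      ≤ A₁ / (supNorm t : ℝ) ^ (2 + 1) * (Real.exp (-(η / n) * supNorm t) * (1 + (supNorm t : ℝ) / n)))
    (hG0g : ∀ t : Pt, 0 < supNorm t → |G t| ≤ B₀ / (supNorm t : ℝ) ^ 2 * Real.exp (-(η / n) * supNorm t))
    (hG1g : ∀ t : Pt, 0 < supNorm t → ∀ i, |Δ_[(Pi.single i 1 : Pt)] G t|
      ≤ B₁ / (supNorm t : ℝ) ^ (2 + 1) * (Real.exp (-(η / n) * supNorm t) * (1 + (supNorm t : ℝ) / n)))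
    (hm : 0 < m) (hmη : m ≤ η) (hmδ : m ≤ δ / 8) (μ ν : Fin 4) :
    (∀ R : ℕ, n ≤ R →
      ∑ z ∈ annulus 4 n R, |(∑' P : (Pt × Pt) × (Pt × Pt),
          V P.1 * W P.2 * ((F (z + (P.2.2 - P.1.1)) - F (z + (P.2.2 - P.1.2))) * (G (z + (P.2.1 - P.1.2)) - G (z + (P.2.2 - P.1.2)))))
          * (z μ : ℝ) * (z ν : ℝ)|
        ≤ 80 * ((CV * CW * (16 * (4 * A₁ * (4 / 3 : ℝ) ^ (2 + 1) * (5 / 4) + 16 * 2 ^ 2 * A₀) * (4 * B₁ * (4 / 3 : ℝ) ^ (2 + 1) * (5 / 4) + 16 * 2 ^ 2 * B₀)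
              * (2 ^ (2 + 1) * (((2 : ℕ).factorial : ℝ) * Real.exp (δ / 2 / 2) * (2 / (δ / 2)) ^ 2) * Real.exp (δ / 2 / 2) * Zl 4 (δ / 2 / 2) ^ 2)
              * (2 ^ (0 + 1) * (((0 : ℕ).factorial : ℝ) * Real.exp (δ / 2 / 2) * (2 / (δ / 2)) ^ 0) * Real.exp (δ / 2 / 2) * Zl 4 (δ / 2 / 2) ^ 2)
            + Real.exp (δ / 4) * (((2 * 2 + 2).factorial : ℝ) * (8 / δ) ^ (2 * 2 + 2))
              * (8 * ((4 * A₁ * (4 / 3 : ℝ) ^ (2 + 1) * (5 / 4) + 16 * 2 ^ 2 * A₀) * Gg + (4 * B₁ * (4 / 3 : ℝ) ^ (2 + 1) * (5 / 4) + 16 * 2 ^ 2 * B₀) * Fg)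
                  * (2 ^ (1 + 1) * (((1 : ℕ).factorial : ℝ) * Real.exp (δ / 2 / 2) * (2 / (δ / 2)) ^ 1) * Real.exp (δ / 2 / 2) * Zl 4 (δ / 2 / 2) ^ 2)
                  * (2 ^ (0 + 1) * (((0 : ℕ).factorial : ℝ) * Real.exp (δ / 2 / 2) * (2 / (δ / 2)) ^ 0) * Real.exp (δ / 2 / 2) * Zl 4 (δ / 2 / 2) ^ 2)
                + 4 * Fg * Gg
                  * (2 ^ (0 + 1) * (((0 : ℕ).factorial : ℝ) * Real.exp (δ / 2 / 2) * (2 / (δ / 2)) ^ 0) * Real.exp (δ / 2 / 2) * Zl 4 (δ / 2 / 2) ^ 2) ^ 2))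
            + CV * CW * (4 * Fg * Gg)
              * (2 ^ (0 + 1) * (((0 : ℕ).factorial : ℝ) * Real.exp (δ / 2) * (2 / δ) ^ 0) * Real.exp (δ / 2) * Zl 4 (δ / 2) ^ 2) ^ 2
              * ((8 : ℝ) ^ (2 * 2 + 2) * Real.exp (8 * m)))
          * (((2 : ℕ).factorial : ℝ) * Real.exp (m / 2) * (2 / m) ^ 2)) * (1 + 2 / m))
    ∧ Summable fun z : Pt => (∑' P : (Pt × Pt) × (Pt × Pt),
          V P.1 * W P.2 * ((F (z + (P.2.2 - P.1.1)) - F (z + (P.2.2 - P.1.2))) * (G (z + (P.2.1 - P.1.2)) - G (z + (P.2.2 - P.1.2)))))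
        * (z μ : ℝ) * (z ν : ℝ) := by
  have hCV : 0 ≤ CV := nonneg_of_loc hV
  have hCW : 0 ≤ CW := nonneg_of_loc hW
  have hFg0 : 0 ≤ Fg := (abs_nonneg _).trans (hFg 0)
  have hGg0 : 0 ≤ Gg := (abs_nonneg _).trans (hGg 0)
  have hZ : 0 < Zl 4 (δ / 2 / 2) := Zl_pos (by positivity)
  have hZ' : 0 < Zl 4 (δ / 2) := Zl_pos (by positivity)
  have hfar := abs_bracket_le_of_graded (a := 2) hδ hV hW hFg hGg hn hη hA0 hA1 hB0 hB1 hF0g hF1g hG0g hG1g hm hmη hmδ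
  have hK : 0 ≤ (CV * CW * (16 * (4 * A₁ * (4 / 3 : ℝ) ^ (2 + 1) * (5 / 4) + 16 * 2 ^ 2 * A₀) * (4 * B₁ * (4 / 3 : ℝ) ^ (2 + 1) * (5 / 4) + 16 * 2 ^ 2 * B₀)
              * (2 ^ (2 + 1) * (((2 : ℕ).factorial : ℝ) * Real.exp (δ / 2 / 2) * (2 / (δ / 2)) ^ 2) * Real.exp (δ / 2 / 2) * Zl 4 (δ / 2 / 2) ^ 2)
              * (2 ^ (0 + 1) * (((0 : ℕ).factorial : ℝ) * Real.exp (δ / 2 / 2) * (2 / (δ / 2)) ^ 0) * Real.exp (δ / 2 / 2) * Zl 4 (δ / 2 / 2) ^ 2)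
            + Real.exp (δ / 4) * (((2 * 2 + 2).factorial : ℝ) * (8 / δ) ^ (2 * 2 + 2))
              * (8 * ((4 * A₁ * (4 / 3 : ℝ) ^ (2 + 1) * (5 / 4) + 16 * 2 ^ 2 * A₀) * Gg + (4 * B₁ * (4 / 3 : ℝ) ^ (2 + 1) * (5 / 4) + 16 * 2 ^ 2 * B₀) * Fg)
                  * (2 ^ (1 + 1) * (((1 : ℕ).factorial : ℝ) * Real.exp (δ / 2 / 2) * (2 / (δ / 2)) ^ 1) * Real.exp (δ / 2 / 2) * Zl 4 (δ / 2 / 2) ^ 2)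
                  * (2 ^ (0 + 1) * (((0 : ℕ).factorial : ℝ) * Real.exp (δ / 2 / 2) * (2 / (δ / 2)) ^ 0) * Real.exp (δ / 2 / 2) * Zl 4 (δ / 2 / 2) ^ 2)
                + 4 * Fg * Gg
                  * (2 ^ (0 + 1) * (((0 : ℕ).factorial : ℝ) * Real.exp (δ / 2 / 2) * (2 / (δ / 2)) ^ 0) * Real.exp (δ / 2 / 2) * Zl 4 (δ / 2 / 2) ^ 2) ^ 2))
            + CV * CW * (4 * Fg * Gg)
              * (2 ^ (0 + 1) * (((0 : ℕ).factorial : ℝ) * Real.exp (δ / 2) * (2 / δ) ^ 0) * Real.exp (δ / 2) * Zl 4 (δ / 2) ^ 2) ^ 2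
              * ((8 : ℝ) ^ (2 * 2 + 2) * Real.exp (8 * m))) := by positivity
  exact ⟨fun R hR => sum_far_abs_le (P := fun z => ∑' P : (Pt × Pt) × (Pt × Pt),
      V P.1 * W P.2 * ((F (z + (P.2.2 - P.1.1)) - F (z + (P.2.2 - P.1.2))) * (G (z + (P.2.1 - P.1.2)) - G (z + (P.2.2 - P.1.2)))))
      hK hm hn hfar μ ν hR,
    summable_moment (P := fun z => ∑' P : (Pt × Pt) × (Pt × Pt),
      V P.1 * W P.2 * ((F (z + (P.2.2 - P.1.1)) - F (z + (P.2.2 - P.1.2))) * (G (z + (P.2.1 - P.1.2)) - G (z + (P.2.2 - P.1.2)))))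
      hK hm hn hfar μ ν⟩

end BubbleChain

/-! ## §2 The identity: under the two PARTIAL zero moments the plain double smear IS the bracket form -/

section Identity

variable {V W : Pt × Pt → ℝ} {F G : Pt → ℝ} {CV CW δ Fg Gg : ℝ}

/-- [folklore] A two-point weight with vanishing sums over its FIRST slot kills any bounded factor of its SECOND slot:
`Σ'_y K(y,u) = 0` (∀ u) ⟹ `Σ'_{(y,u)} K(y,u)·h(u) = 0` (absolute summability assumed). -/
theorem tsum_mul_snd_eq_zero {K : Pt × Pt → ℝ} {h : Pt → ℝ} (hs : Summable fun q : Pt × Pt => K q * h q.2)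
    (hK0 : ∀ u, ∑' y, K (y, u) = 0) : ∑' q : Pt × Pt, K q * h q.2 = 0 := by
  have hs' : Summable fun q : Pt × Pt => K q.swap * h q.1 := by
    have h1 := (Equiv.prodComm Pt Pt).summable_iff.mpr hs
    refine h1.congr fun q => ?_
    simp [Prod.swap]
  calc ∑' q : Pt × Pt, K q * h q.2 = ∑' q : Pt × Pt, K q.swap * h q.1 := by
        rw [← (Equiv.prodComm Pt Pt).tsum_eq (fun q : Pt × Pt => K q * h q.2)]
        exact tsum_congr fun q => by simp [Equiv.prodComm_apply, Prod.swap]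
    _ = ∑' u, ∑' y, K (y, u) * h u := hs'.tsum_prod
    _ = ∑' u, (∑' y, K (y, u)) * h u := by
        refine tsum_congr fun u => ?_
        rw [tsum_mul_right]
    _ = 0 := by simp [hK0]

/-- [folklore] Summability of `(p,q) ↦ V p · W q · φ(p,q)` for exponentially localised `V, W` and bounded `φ`. -/
theorem summable_VW_mul (hδ : 0 < δ)
    (hV : ∀ p : Pt × Pt, |V p| ≤ CV * (Real.exp (-δ * l1 p.1) * Real.exp (-δ * l1 p.2)))
    (hW : ∀ q : Pt × Pt, |W q| ≤ CW * (Real.exp (-δ * l1 q.1) * Real.exp (-δ * l1 q.2)))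
    {φ : (Pt × Pt) × (Pt × Pt) → ℝ} {B : ℝ} (hφ : ∀ P, |φ P| ≤ B) :
    Summable fun P : (Pt × Pt) × (Pt × Pt) => V P.1 * W P.2 * φ P := by
  have hCV : 0 ≤ CV := nonneg_of_loc hV
  have hCW : 0 ≤ CW := nonneg_of_loc hW
  have hB : 0 ≤ B := (abs_nonneg _).trans (hφ ((0, 0), (0, 0)))
  obtain ⟨hs0, -⟩ := tsum_prod_expWeight_pow_le (D := 4) hδ 0
  set ω : Pt × Pt → ℝ := fun p => Real.exp (-δ * l1 p.1) * Real.exp (-δ * l1 p.2) * ((l1 p.1 + 1) + (l1 p.2 + 1)) ^ 0 with hω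
  have hωnn : 0 ≤ ω := fun p => by simp only [hω]; positivity
  have H : Summable (fun P : (Pt × Pt) × (Pt × Pt) => ω P.1 * ω P.2) := hs0.mul_of_nonneg hs0 hωnn hωnn
  refine Summable.of_norm_bounded ((H.mul_left (CV * CW * B))) (fun P => ?_)
  rw [Real.norm_eq_abs, abs_mul, abs_mul]
  simp only [hω, pow_zero, mul_one]
  calc |V P.1| * |W P.2| * |φ P| ≤ (CV * (Real.exp (-δ * l1 P.1.1) * Real.exp (-δ * l1 P.1.2)))
        * (CW * (Real.exp (-δ * l1 P.2.1) * Real.exp (-δ * l1 P.2.2))) * B :=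
        mul_le_mul (mul_le_mul (hV P.1) (hW P.2) (abs_nonneg _) (by positivity)) (hφ P) (abs_nonneg _) (by positivity)
    _ = _ := by ring

/-- [folklore] Summability of `q ↦ W q · h(q)` for an exponentially localised `W` and bounded `h`. -/
theorem summable_W_mul (hδ : 0 < δ) (hW : ∀ q : Pt × Pt, |W q| ≤ CW * (Real.exp (-δ * l1 q.1) * Real.exp (-δ * l1 q.2)))
    {h : Pt × Pt → ℝ} {B : ℝ} (hh : ∀ q, |h q| ≤ B) : Summable fun q : Pt × Pt => W q * h q := by
  have hs := summable_loc_mul_pow hδ hW 0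
  simp only [pow_zero, mul_one] at hs
  refine Summable.of_norm_bounded (hs.mul_right B) (fun q => ?_)
  rw [Real.norm_eq_abs, abs_mul]
  exact mul_le_mul_of_nonneg_left (hh q) (abs_nonneg _)

/-- [folklore] TYPE A: a factor not depending on `y` is killed by `Σ_y W(y,u) = 0`:
`Σ'_{(x,w),(y,u)} V(x,w)W(y,u)·φ((x,w),u) = 0` for bounded `φ`. -/
theorem tsum_VW_eq_zero_of_snd (hδ : 0 < δ)
    (hV : ∀ p : Pt × Pt, |V p| ≤ CV * (Real.exp (-δ * l1 p.1) * Real.exp (-δ * l1 p.2)))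
    (hW : ∀ q : Pt × Pt, |W q| ≤ CW * (Real.exp (-δ * l1 q.1) * Real.exp (-δ * l1 q.2)))
    (hW0 : ∀ u, ∑' y, W (y, u) = 0) {φ : (Pt × Pt) → Pt → ℝ} {B : ℝ} (hφ : ∀ p u, |φ p u| ≤ B) :
    ∑' P : (Pt × Pt) × (Pt × Pt), V P.1 * W P.2 * φ P.1 P.2.2 = 0 := by
  have hs := summable_VW_mul hδ hV hW (φ := fun P => φ P.1 P.2.2) (fun P => hφ P.1 P.2.2)
  rw [hs.tsum_prod]
  simp only
  have hin : ∀ p : Pt × Pt, ∑' q : Pt × Pt, V p * W q * φ p q.2 = 0 := fun p => by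
    have h1 : ∑' q : Pt × Pt, W q * φ p q.2 = 0 :=
      tsum_mul_snd_eq_zero (K := W) (h := fun u => φ p u) (summable_W_mul hδ hW (h := fun q => φ p q.2) (fun q => hφ p q.2)) hW0
    calc ∑' q : Pt × Pt, V p * W q * φ p q.2 = ∑' q : Pt × Pt, V p * (W q * φ p q.2) := tsum_congr fun q => by ring
      _ = V p * ∑' q : Pt × Pt, W q * φ p q.2 := tsum_mul_left
      _ = 0 := by rw [h1, mul_zero]
  simp [hin]

/-- [folklore] TYPE B: a factor not depending on `x` is killed by `Σ_x V(x,w) = 0`: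
`Σ'_{(x,w),(y,u)} V(x,w)W(y,u)·ψ(w,(y,u)) = 0` for bounded `ψ`. -/
theorem tsum_VW_eq_zero_of_fst (hδ : 0 < δ)
    (hV : ∀ p : Pt × Pt, |V p| ≤ CV * (Real.exp (-δ * l1 p.1) * Real.exp (-δ * l1 p.2)))
    (hW : ∀ q : Pt × Pt, |W q| ≤ CW * (Real.exp (-δ * l1 q.1) * Real.exp (-δ * l1 q.2)))
    (hV0 : ∀ w, ∑' x, V (x, w) = 0) {ψ : Pt → (Pt × Pt) → ℝ} {B : ℝ} (hψ : ∀ w q, |ψ w q| ≤ B) :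
    ∑' P : (Pt × Pt) × (Pt × Pt), V P.1 * W P.2 * ψ P.1.2 P.2 = 0 := by
  have hs := summable_VW_mul hδ hV hW (φ := fun P => ψ P.1.2 P.2) (fun P => hψ P.1.2 P.2)
  -- swap the outer order: sum over `p` first for fixed `q`
  have hs' : Summable fun Q : (Pt × Pt) × (Pt × Pt) => V Q.2 * W Q.1 * ψ Q.2.2 Q.1 := by
    have h1 := (Equiv.prodComm (Pt × Pt) (Pt × Pt)).summable_iff.mpr hs
    refine h1.congr fun Q => ?_
    simp [Prod.swap]
  have e : ∑' P : (Pt × Pt) × (Pt × Pt), V P.1 * W P.2 * ψ P.1.2 P.2 = ∑' Q : (Pt × Pt) × (Pt × Pt), V Q.2 * W Q.1 * ψ Q.2.2 Q.1 := by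
    rw [← (Equiv.prodComm (Pt × Pt) (Pt × Pt)).tsum_eq (fun P : (Pt × Pt) × (Pt × Pt) => V P.1 * W P.2 * ψ P.1.2 P.2)]
    exact tsum_congr fun Q => by simp [Equiv.prodComm_apply, Prod.swap]
  rw [e, hs'.tsum_prod]
  simp only
  have hin : ∀ q : Pt × Pt, ∑' p : Pt × Pt, V p * W q * ψ p.2 q = 0 := fun q => by
    have h1 : ∑' p : Pt × Pt, V p * ψ p.2 q = 0 :=
      tsum_mul_snd_eq_zero (K := V) (h := fun w => ψ w q) (summable_W_mul hδ hV (h := fun p => ψ p.2 q) (fun p => hψ p.2 q)) hV0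
    calc ∑' p : Pt × Pt, V p * W q * ψ p.2 q = ∑' p : Pt × Pt, (V p * ψ p.2 q) * W q := tsum_congr fun p => by ring
      _ = (∑' p : Pt × Pt, V p * ψ p.2 q) * W q := tsum_mul_right
      _ = 0 := by rw [h1, zero_mul]
  simp [hin]

/-- [folklore] **THE BUBBLE IS THE BRACKET FORM.**  For exponentially localised two-point vertex weights with the PARTIAL zero moments
`Σ_x V(x,w) = 0` (∀ w) and `Σ_y W(y,u) = 0` (∀ u) and bounded legs:
`Σ' V(x,w)W(y,u)·F(z+u−x)·G(z+y−w) = Σ' V(x,w)W(y,u)·(F(z+u−x) − F(z+u−w))·(G(z+y−w) − G(z+u−w))`. -/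
theorem bubble_eq_bracket (hδ : 0 < δ)
    (hV : ∀ p : Pt × Pt, |V p| ≤ CV * (Real.exp (-δ * l1 p.1) * Real.exp (-δ * l1 p.2)))
    (hW : ∀ q : Pt × Pt, |W q| ≤ CW * (Real.exp (-δ * l1 q.1) * Real.exp (-δ * l1 q.2)))
    (hFg : ∀ t, |F t| ≤ Fg) (hGg : ∀ t, |G t| ≤ Gg) (hV0 : ∀ w, ∑' x, V (x, w) = 0) (hW0 : ∀ u, ∑' y, W (y, u) = 0) (z : Pt) :
    ∑' P : (Pt × Pt) × (Pt × Pt), V P.1 * W P.2 * (F (z + (P.2.2 - P.1.1)) * G (z + (P.2.1 - P.1.2)))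
      = ∑' P : (Pt × Pt) × (Pt × Pt),
          V P.1 * W P.2 * ((F (z + (P.2.2 - P.1.1)) - F (z + (P.2.2 - P.1.2))) * (G (z + (P.2.1 - P.1.2)) - G (z + (P.2.2 - P.1.2)))) := by
  have hFg0 : 0 ≤ Fg := (abs_nonneg _).trans (hFg z)
  have hGg0 : 0 ≤ Gg := (abs_nonneg _).trans (hGg z)
  have hFG : ∀ a b : Pt, |F a * G b| ≤ Fg * Gg := fun a b => by
    rw [abs_mul]; exact mul_le_mul (hFg a) (hGg b) (abs_nonneg _) hFg0
  -- the four families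
  have hL := summable_VW_mul hδ hV hW (φ := fun P => F (z + (P.2.2 - P.1.1)) * G (z + (P.2.1 - P.1.2))) (fun P => hFG _ _)
  have hA := summable_VW_mul hδ hV hW (φ := fun P => F (z + (P.2.2 - P.1.1)) * G (z + (P.2.2 - P.1.2))) (fun P => hFG _ _)
  have hB := summable_VW_mul hδ hV hW (φ := fun P => F (z + (P.2.2 - P.1.2)) * G (z + (P.2.1 - P.1.2))) (fun P => hFG _ _)
  have hC := summable_VW_mul hδ hV hW (φ := fun P => F (z + (P.2.2 - P.1.2)) * G (z + (P.2.2 - P.1.2))) (fun P => hFG _ _)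
  -- the three vanishing sums
  have zA : ∑' P : (Pt × Pt) × (Pt × Pt), V P.1 * W P.2 * (F (z + (P.2.2 - P.1.1)) * G (z + (P.2.2 - P.1.2))) = 0 :=
    tsum_VW_eq_zero_of_snd hδ hV hW hW0 (φ := fun p u => F (z + (u - p.1)) * G (z + (u - p.2))) (fun p u => hFG _ _)
  have zB : ∑' P : (Pt × Pt) × (Pt × Pt), V P.1 * W P.2 * (F (z + (P.2.2 - P.1.2)) * G (z + (P.2.1 - P.1.2))) = 0 :=
    tsum_VW_eq_zero_of_fst hδ hV hW hV0 (ψ := fun w q => F (z + (q.2 - w)) * G (z + (q.1 - w))) (fun w q => hFG _ _)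
  have zC : ∑' P : (Pt × Pt) × (Pt × Pt), V P.1 * W P.2 * (F (z + (P.2.2 - P.1.2)) * G (z + (P.2.2 - P.1.2))) = 0 :=
    tsum_VW_eq_zero_of_snd hδ hV hW hW0 (φ := fun p u => F (z + (u - p.2)) * G (z + (u - p.2))) (fun p u => hFG _ _)
  -- linearity
  have e : ∀ P : (Pt × Pt) × (Pt × Pt),
      V P.1 * W P.2 * ((F (z + (P.2.2 - P.1.1)) - F (z + (P.2.2 - P.1.2))) * (G (z + (P.2.1 - P.1.2)) - G (z + (P.2.2 - P.1.2))))
        = V P.1 * W P.2 * (F (z + (P.2.2 - P.1.1)) * G (z + (P.2.1 - P.1.2)))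
          - V P.1 * W P.2 * (F (z + (P.2.2 - P.1.1)) * G (z + (P.2.2 - P.1.2)))
          - V P.1 * W P.2 * (F (z + (P.2.2 - P.1.2)) * G (z + (P.2.1 - P.1.2)))
          + V P.1 * W P.2 * (F (z + (P.2.2 - P.1.2)) * G (z + (P.2.2 - P.1.2))) := fun P => by ring
  rw [tsum_congr e, ((hL.sub hA).sub hB).tsum_add hC, (hL.sub hA).tsum_sub hB, hL.tsum_sub hA, zA, zB, zC]
  ring

end Identity

end Summit.QuantumFields.BalabanUV.Beta.FP.FarRegionBubbleMoment

end
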